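import Mathlib
import Summits.NavierStokesRegularity.NavierStokesRegularity.Theorems.EulerZoomLiouvillePowerGaugeEulerLiouvilleModulatedPatternPast
import Summits.NavierStokesRegularity.NavierStokesRegularity.Theorems.EulerZoomLiouvillePowerGaugeEulerLiouvilleSupercriticalModulationPast
import Summits.NavierStokesRegularity.NavierStokesRegularity.Theorems.EulerZoomLiouvillePowerGaugeEulerLiouvilleSeparableCollapseBridge
import HarnessLib

/-!
# Crux `EulerZoomLiouville.PowerGaugeEulerLiouville` (stmt-NavierStokesRegularity-19832), stub `stub_nonSelfSimilarRest`:
# the `E`-GAUGE TWO-PATTERN ENGINE for `u = U₀(x) + θ(τ) U₁(x)` — tools for the evanescent residual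

Helper file (theorems only; `--supports stmt-NavierStokesRegularity-19832`; def-free).  Hand leafhand-ns-eulerzoomliouville-11 g0.
After this hand's files the pattern lane `u = U₀ + θ(τ)U₁` is left with the EVANESCENT modulations (`θ → r`, square-integrable tail).  The
plan (census T-e): two good slices give weak gradients `G₀, G₁` with `H(t) = G₀ + θ(t) G₁` (`Evanescent.gradients_of_two_slices`);
a window `J` where `|θ − r| > 2ε` against the far past where `|θ − r| ≤ ε` gives, by Tonelli and the `E`-gauge,
`ε² |I_far| |J| ∫_{B_b}|G₁|²_F ≤ 4 |I_b| c b^{1−ρ}` and `|I_b| ∫_{B_b}|G₀|²_F ≤ 2 c b^{1−ρ} + 2 (∫_{I_b} θ²) ∫_{B_b}|G₁|²_F`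
(`Evanescent.engine`); with `∫θ² ≤ κ` this yields `∫_{B_b}|G₀|² ≲ b^{−1−ρ} → 0`, `U₀` constant, and the separable closure finishes.
This file lands the two reusable steps (gradients + engine); the assembly is left to the next hand (census T-e).

WHAT THIS IS NOT: not a proof of the stub or of the crux; nothing about Navier–Stokes. [folklore]
-/

noncomputable section

-- flat `Theorems/<Route><Decl>…` files of one crux share the namespace of the crux (tree convention)
set_option linter.dupNamespace false

open MeasureTheory Set Filter Topology Metric Function TopologicalSpace
open scoped RealInnerProductSpace NNReal ENNReal

namespace Summit.NavierStokesRegularity.NavierStokesRegularity.Theorems.PowerGaugeEulerLiouville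

open Literature.Analysis Literature.Analysis.FunctionSpaces Literature.Analysis.FluidPDE

namespace Evanescent

/-- **Weak gradients from two slices.**  If `U₀ + θ(τ) U₁` has the weak gradient `H(τ)` for every `τ ∈ S` and `θ(τa) ≠ θ(τb)` for two
members of `S`, then `U₁`, `U₀` have weak gradients `G₁ = (θ(τb) − θ(τa))⁻¹ (H(τb) − H(τa))`, `G₀ = H(τa) − θ(τa) G₁`, and
`H(τ) = G₀ + θ(τ) G₁` a.e. for every `τ ∈ S` (uniqueness of weak gradients). [folklore] -/
theorem gradients_of_two_slices {U₀ U₁ : EuclideanSpace ℝ (Fin 3) → EuclideanSpace ℝ (Fin 3)}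
    {H : ℝ → EuclideanSpace ℝ (Fin 3) → EuclideanSpace ℝ (Fin 3) →L[ℝ] EuclideanSpace ℝ (Fin 3)} {θ : ℝ → ℝ} {S : Set ℝ}
    (hW : ∀ τ, τ ∈ S → HasWeakFDerivOn (⊤ : Opens (EuclideanSpace ℝ (Fin 3))) volume (fun x => U₀ x + θ τ • U₁ x) (H τ))
    {τa τb : ℝ} (ha : τa ∈ S) (hb : τb ∈ S) (hab : θ τb - θ τa ≠ 0) :
    HasWeakFDerivOn (⊤ : Opens (EuclideanSpace ℝ (Fin 3))) volume U₁ ((θ τb - θ τa)⁻¹ • (H τb - H τa)) ∧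
    HasWeakFDerivOn (⊤ : Opens (EuclideanSpace ℝ (Fin 3))) volume U₀ (H τa - θ τa • ((θ τb - θ τa)⁻¹ • (H τb - H τa))) ∧
    ∀ τ, τ ∈ S → H τ =ᵐ[volume] fun y =>
      (H τa - θ τa • ((θ τb - θ τa)⁻¹ • (H τb - H τa))) y + θ τ • ((θ τb - θ τa)⁻¹ • (H τb - H τa)) y := by
  set G₁ : EuclideanSpace ℝ (Fin 3) → EuclideanSpace ℝ (Fin 3) →L[ℝ] EuclideanSpace ℝ (Fin 3) :=
    (θ τb - θ τa)⁻¹ • (H τb - H τa) with hG₁def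
  have hGU₁ : HasWeakFDerivOn (⊤ : Opens (EuclideanSpace ℝ (Fin 3))) volume U₁ G₁ := by
    have h := ((hW τb hb).sub (hW τa ha)).const_smul (θ τb - θ τa)⁻¹
    have e : ((θ τb - θ τa)⁻¹ • ((fun x => U₀ x + θ τb • U₁ x) - fun x => U₀ x + θ τa • U₁ x)) = U₁ := by
      funext x
      simp only [Pi.smul_apply, Pi.sub_apply]
      rw [add_sub_add_left_eq_sub, ← sub_smul, smul_smul, inv_mul_cancel₀ hab, one_smul]
    rwa [e] at h
  have hGU₀ : HasWeakFDerivOn (⊤ : Opens (EuclideanSpace ℝ (Fin 3))) volume U₀ (H τa - θ τa • G₁) := by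
    have h := (hW τa ha).sub (hGU₁.const_smul (θ τa))
    have e : ((fun x => U₀ x + θ τa • U₁ x) - θ τa • U₁) = U₀ := by
      funext x; simp only [Pi.sub_apply, Pi.smul_apply]; abel
    rwa [e] at h
  refine ⟨hGU₁, hGU₀, fun τ hτ => ?_⟩
  have h1 : HasWeakFDerivOn (⊤ : Opens (EuclideanSpace ℝ (Fin 3))) volume
      ((fun x => U₀ x + θ τa • U₁ x) - (θ τa - θ τ) • U₁) (H τa - (θ τa - θ τ) • G₁) :=
    (hW τa ha).sub (hGU₁.const_smul (θ τa - θ τ))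
  have e : ((fun x => U₀ x + θ τa • U₁ x) - (θ τa - θ τ) • U₁) = fun x => U₀ x + θ τ • U₁ x := by
    funext x
    simp only [Pi.sub_apply, Pi.smul_apply]
    rw [sub_smul]
    abel
  rw [e] at h1
  have h2 := HasWeakFDerivOn.unique_holds (hW τ hτ) h1
  rw [Opens.coe_top, Measure.restrict_univ] at h2
  filter_upwards [h2] with y hy
  rw [hy]
  have e2 : (H τa - θ τa • G₁) y = H τa y - θ τa • G₁ y := rfl
  have e3 : (H τa - (θ τa - θ τ) • G₁) y = H τa y - (θ τa - θ τ) • G₁ y := rfl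
  rw [e2, e3]
  module

/-- Rectangle bookkeeping: `∫_J ∫_{I'} 2 (e t + e t') dt' dt = 2 (|I'| ∫_J e + |J| ∫_{I'} e)`. [folklore] -/
theorem lintegral_rect_two_mul_add {J I' : Set ℝ} {e : ℝ → ℝ≥0∞} (heJ : AEMeasurable e (volume.restrict J))
    (heI : AEMeasurable e (volume.restrict I')) :
    ∫⁻ t in J, ∫⁻ t' in I', 2 * (e t + e t') = 2 * (volume I' * ∫⁻ t in J, e t) + 2 * (volume J * ∫⁻ t in I', e t) := by
  have h1 : ∀ t, ∫⁻ t' in I', 2 * (e t + e t') = 2 * (e t * volume I') + 2 * ∫⁻ t' in I', e t' := by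
    intro t
    rw [lintegral_const_mul' _ _ (by norm_num), lintegral_add_right' _ heI, setLIntegral_const, mul_add]
  simp_rw [h1]
  rw [lintegral_add_right _ measurable_const, lintegral_const_mul' _ _ (by norm_num), setLIntegral_const,
    lintegral_mul_const'' _ heJ]
  rw [mul_comm (volume I')]
  ring

/-- **THE `E`-GAUGE TWO-PATTERN ENGINE.**  Let `H` be the weak spatial gradient of a class member with `E`-gauge `a^ρ E(a) ≤ c`, and
suppose that for a.e. `t < T₁ ≤ 0` (the "good" times, a set `S`) `H(t) = G₀ + θ(t) G₁` a.e., with `θ` measurable; let `J = ball t₁ δ`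
be a window of good sign (`2ε < |θ|` on `J`, `J ⊆ (−∞,T₁)`) and `M ≤ T₁` a threshold below which `|θ| ≤ ε`.  Then for every
`b > 0` with `−b² < M − 1`, writing `I = (−b², T₁)`, `I_far = (−b², M − 1)`:
`ε² |I_far| |J| ∫_{B_b}|G₁|²_F ≤ 4 |I| c b^{1−ρ}` and `|I| ∫_{B_b}|G₀|²_F ≤ 2 c b^{1−ρ} + 2 (∫_I θ²) ∫_{B_b}|G₁|²_F`. [folklore] -/
theorem engine {ρ : ℝ} {u : ℝ → EuclideanSpace ℝ (Fin 3) → EuclideanSpace ℝ (Fin 3)}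
    {H : ℝ → EuclideanSpace ℝ (Fin 3) → EuclideanSpace ℝ (Fin 3) →L[ℝ] EuclideanSpace ℝ (Fin 3)} {c : ℝ≥0}
    (hH : HasWeakSpatialGradientOn (slab (EuclideanSpace ℝ (Fin 3)) (Iio 0) isOpen_Iio) u H)
    (hE : ∀ a : ℝ, 0 < a → ENNReal.ofReal (a ^ ρ) * cknE a (0 : ℝ × EuclideanSpace ℝ (Fin 3)) H ≤ (c : ℝ≥0∞))
    {T₁ : ℝ} (hT₁ : T₁ ≤ 0) {θ : ℝ → ℝ} (hθm : Measurable θ)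
    {G₀ G₁ : EuclideanSpace ℝ (Fin 3) → EuclideanSpace ℝ (Fin 3) →L[ℝ] EuclideanSpace ℝ (Fin 3)} {S : Set ℝ}
    (hS : ∀ᵐ t ∂(volume.restrict (Iio T₁)), t ∈ S) (hSm : ∀ t, t ∈ S → AEStronglyMeasurable (H t) volume)
    (hrel : ∀ t, t ∈ S → H t =ᵐ[volume] fun y => G₀ y + θ t • G₁ y)
    {t₁ δ ε M : ℝ} (hε : 0 ≤ ε) (hJ : ∀ s, s ∈ ball t₁ δ → 2 * ε < |θ s| ∧ s < T₁) (hMT : M ≤ T₁) (hM : ∀ s, s ≤ M → |θ s| ≤ ε)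
    {b : ℝ} (hb : 0 < b) (hbM : -(b ^ 2) < M - 1) :
    ENNReal.ofReal (ε ^ 2) * (volume (Ioo (-(b ^ 2)) (M - 1)) * volume (ball t₁ δ)) *
        ∫⁻ y in ball (0 : EuclideanSpace ℝ (Fin 3)) b, ENNReal.ofReal (frobeniusNormSq (G₁ y)) ≤
      4 * volume (Ioo (-(b ^ 2)) T₁) * ENNReal.ofReal ((c : ℝ) * b ^ (1 - ρ)) ∧
    volume (Ioo (-(b ^ 2)) T₁) * ∫⁻ y in ball (0 : EuclideanSpace ℝ (Fin 3)) b, ENNReal.ofReal (frobeniusNormSq (G₀ y)) ≤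
      2 * ENNReal.ofReal ((c : ℝ) * b ^ (1 - ρ)) +
        2 * ((∫⁻ t in Ioo (-(b ^ 2)) T₁, ‖θ t‖ₑ ^ 2) *
          ∫⁻ y in ball (0 : EuclideanSpace ℝ (Fin 3)) b, ENNReal.ofReal (frobeniusNormSq (G₁ y))) := by
  set F : ℝ × EuclideanSpace ℝ (Fin 3) → ℝ≥0∞ := fun q => ENNReal.ofReal (frobeniusNormSq (H q.1 q.2)) with hF
  set I : Set ℝ := Ioo (-(b ^ 2)) T₁ with hI
  set J : Set ℝ := ball t₁ δ with hJdef
  set If : Set ℝ := Ioo (-(b ^ 2)) (M - 1) with hIf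
  set e : ℝ → ℝ≥0∞ := fun t => ∫⁻ y in ball (0 : EuclideanSpace ℝ (Fin 3)) b, F (t, y) with he
  set Ig₁ : ℝ≥0∞ := ∫⁻ y in ball (0 : EuclideanSpace ℝ (Fin 3)) b, ENNReal.ofReal (frobeniusNormSq (G₁ y)) with hIg₁
  have hJM : ∀ s, s ∈ J → M < s := fun s hs => by
    by_contra h; push Not at h; have := hM s h; linarith [(hJ s hs).1, abs_nonneg (θ s)]
  have hJI : J ⊆ I := fun s hs => ⟨by linarith [hJM s hs], (hJ s hs).2⟩
  have hIfI : If ⊆ I := Ioo_subset_Ioo le_rfl (by linarith)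
  have hFm : AEMeasurable F ((volume.restrict I).prod (volume.restrict (ball (0 : EuclideanSpace ℝ (Fin 3)) b))) := by
    have hsub : I ×ˢ ball (0 : EuclideanSpace ℝ (Fin 3)) b ⊆
        ((slab (EuclideanSpace ℝ (Fin 3)) (Iio 0) isOpen_Iio : Opens _) : Set (ℝ × EuclideanSpace ℝ (Fin 3))) := by
      rw [coe_slab]
      exact prod_mono (fun t ht => lt_of_lt_of_le ht.2 hT₁) (subset_univ _)
    have hsm : AEStronglyMeasurable (uncurry H) (volume.restrict (I ×ˢ ball (0 : EuclideanSpace ℝ (Fin 3)) b)) :=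
      hH.locallyIntegrableOn_grad.aestronglyMeasurable.mono_measure (Measure.restrict_mono hsub le_rfl)
    rw [Measure.volume_eq_prod, ← Measure.prod_restrict] at hsm
    exact ((ENNReal.continuous_ofReal.comp continuous_frobeniusNormSq').comp_aestronglyMeasurable hsm).aemeasurable
  have hslm : ∀ t, t ∈ S → AEMeasurable (fun y => F (t, y)) (volume.restrict (ball (0 : EuclideanSpace ℝ (Fin 3)) b)) :=
    fun t ht => ((ENNReal.continuous_ofReal.comp continuous_frobeniusNormSq').comp_aestronglyMeasurable (hSm t ht).restrict).aemeasurable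
  have hem : AEMeasurable e (volume.restrict I) := hFm.lintegral_prod_right'
  have hemJ : AEMeasurable e (volume.restrict J) := hem.mono_measure (Measure.restrict_mono hJI le_rfl)
  have hemIf : AEMeasurable e (volume.restrict If) := hem.mono_measure (Measure.restrict_mono hIfI le_rfl)
  have hwinE : ∫⁻ t in I, e t ≤ ENNReal.ofReal ((c : ℝ) * b ^ (1 - ρ)) := by
    have hprod : (volume.restrict (I ×ˢ ball (0 : EuclideanSpace ℝ (Fin 3)) b) : Measure (ℝ × EuclideanSpace ℝ (Fin 3))) =
        (volume.restrict I).prod (volume.restrict (ball (0 : EuclideanSpace ℝ (Fin 3)) b)) := by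
      rw [Measure.volume_eq_prod, Measure.prod_restrict]
    have hton : ∫⁻ q in I ×ˢ ball (0 : EuclideanSpace ℝ (Fin 3)) b, F q = ∫⁻ t in I, e t := by
      rw [hprod]; exact lintegral_prod _ hFm
    rw [← hton]
    exact (lintegral_mono_set (prod_mono (Ioo_subset_Ioo le_rfl hT₁) Subset.rfl)).trans
      (TimePeriodic.setLIntegral_window_le_of_gaugeE hb le_rfl le_rfl (hE b hb))
  have hgJ : ∀ᵐ t ∂(volume.restrict J), t ∈ S := ae_restrict_of_ae_restrict_of_subset (fun s hs => (hJ s hs).2) hS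
  have hgIf : ∀ᵐ t ∂(volume.restrict If), t ∈ S :=
    ae_restrict_of_ae_restrict_of_subset (fun s hs => lt_of_lt_of_le (by linarith [hs.2] : s < M) hMT) hS
  have hgI : ∀ᵐ t ∂(volume.restrict I), t ∈ S := ae_restrict_of_ae_restrict_of_subset (fun t ht => ht.2) hS
  have hconv : ∀ (r : ℝ) (L : EuclideanSpace ℝ (Fin 3) →L[ℝ] EuclideanSpace ℝ (Fin 3)),
      ‖r‖ₑ ^ 2 * ENNReal.ofReal (frobeniusNormSq L) = ENNReal.ofReal (frobeniusNormSq (r • L)) := by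
    intro r L
    rw [frobeniusNormSq_smul, ENNReal.ofReal_mul (sq_nonneg _), Real.enorm_eq_ofReal_abs, ← ENNReal.ofReal_pow (abs_nonneg _), sq_abs]
  have htwo : ∀ x y : ℝ, 0 ≤ x → 0 ≤ y → ENNReal.ofReal (2 * (x + y)) = 2 * ENNReal.ofReal x + 2 * ENNReal.ofReal y := by
    intro x y hx hy
    rw [ENNReal.ofReal_mul (by norm_num), ENNReal.ofReal_ofNat, ENNReal.ofReal_add hx hy, mul_add]
  refine ⟨?_, ?_⟩
  · -- (a) pairs `(t, t') ∈ J × I_far`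
    have hpair : ∀ t t', t ∈ S → t' ∈ S → t ∈ J → t' ∈ If → ENNReal.ofReal (ε ^ 2) * Ig₁ ≤ 2 * (e t + e t') := by
      intro t t' ht ht' htJ ht'I
      have hgap : ε ^ 2 ≤ (θ t - θ t') ^ 2 := by
        have ht'M : t' ≤ M := by have := ht'I.2; linarith
        have h3 : ε ≤ |θ t - θ t'| := by
          have := abs_sub_abs_le_abs_sub (θ t) (θ t'); linarith [(hJ t htJ).1, hM t' ht'M]
        have h4 := pow_le_pow_left₀ hε h3 2
        rwa [sq_abs] at h4
      calc ENNReal.ofReal (ε ^ 2) * Ig₁ ≤ ‖θ t - θ t'‖ₑ ^ 2 * Ig₁ := by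
            gcongr
            rw [Real.enorm_eq_ofReal_abs, ← ENNReal.ofReal_pow (abs_nonneg _), sq_abs]
            exact ENNReal.ofReal_le_ofReal hgap
        _ ≤ 2 * (e t + e t') := by
            rw [hIg₁, ← lintegral_const_mul' _ _ (ENNReal.pow_ne_top enorm_ne_top), he, mul_add]
            simp only
            rw [← lintegral_const_mul' _ _ (by norm_num), ← lintegral_const_mul' _ _ (by norm_num),
              ← lintegral_add_left' ((hslm t ht).const_mul _)]
            refine lintegral_mono_ae (ae_restrict_of_ae ?_)
            filter_upwards [hrel t ht, hrel t' ht'] with y hy hy'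
            simp only [hF]
            have hd : H t y - H t' y = (θ t - θ t') • G₁ y := by rw [hy, hy']; module
            have hsub := ModulatedPattern.frobeniusNormSq_sub_le (H t y) (H t' y)
            rw [hd] at hsub
            rw [hconv, ← htwo _ _ (frobeniusNormSq_nonneg _) (frobeniusNormSq_nonneg _)]
            exact ENNReal.ofReal_le_ofReal hsub
    have hdouble : ∫⁻ t in J, ∫⁻ t' in If, ENNReal.ofReal (ε ^ 2) * Ig₁ ≤ ∫⁻ t in J, ∫⁻ t' in If, 2 * (e t + e t') := by
      refine lintegral_mono_ae ?_
      filter_upwards [hgJ, ae_restrict_mem measurableSet_ball] with t ht htJ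
      refine lintegral_mono_ae ?_
      filter_upwards [hgIf, ae_restrict_mem measurableSet_Ioo] with t' ht' ht'I
      exact hpair t t' ht ht' htJ ht'I
    have hlhs : ∫⁻ t in J, ∫⁻ t' in If, ENNReal.ofReal (ε ^ 2) * Ig₁ = ENNReal.ofReal (ε ^ 2) * (volume If * volume J) * Ig₁ := by
      rw [setLIntegral_const, setLIntegral_const]; ring
    rw [← hlhs]
    refine hdouble.trans ?_
    rw [lintegral_rect_two_mul_add hemJ hemIf]
    calc 2 * (volume If * ∫⁻ t in J, e t) + 2 * (volume J * ∫⁻ t in If, e t)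
        ≤ 2 * (volume I * ∫⁻ t in I, e t) + 2 * (volume I * ∫⁻ t in I, e t) := by
          gcongr
      _ = 4 * volume I * ∫⁻ t in I, e t := by ring
      _ ≤ 4 * volume I * ENNReal.ofReal ((c : ℝ) * b ^ (1 - ρ)) := by gcongr
  · -- (b) the `G₀` estimate
    have hpt : ∀ t, t ∈ S → ∫⁻ y in ball (0 : EuclideanSpace ℝ (Fin 3)) b, ENNReal.ofReal (frobeniusNormSq (G₀ y)) ≤
        2 * e t + 2 * (‖θ t‖ₑ ^ 2 * Ig₁) := by
      intro t ht
      rw [hIg₁, ← lintegral_const_mul' _ _ (ENNReal.pow_ne_top enorm_ne_top), he]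
      simp only
      rw [← lintegral_const_mul' _ _ (by norm_num), ← lintegral_const_mul' _ _ (by norm_num),
        ← lintegral_add_left' ((hslm t ht).const_mul _)]
      refine lintegral_mono_ae (ae_restrict_of_ae ?_)
      filter_upwards [hrel t ht] with y hy
      simp only [hF]
      have hd : G₀ y = H t y - θ t • G₁ y := by rw [hy]; module
      have hsub := ModulatedPattern.frobeniusNormSq_sub_le (H t y) (θ t • G₁ y)
      rw [← hd] at hsub
      rw [hconv, ← htwo _ _ (frobeniusNormSq_nonneg _) (frobeniusNormSq_nonneg _)]
      exact ENNReal.ofReal_le_ofReal hsub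
    calc volume I * ∫⁻ y in ball (0 : EuclideanSpace ℝ (Fin 3)) b, ENNReal.ofReal (frobeniusNormSq (G₀ y))
        = ∫⁻ t in I, ∫⁻ y in ball (0 : EuclideanSpace ℝ (Fin 3)) b, ENNReal.ofReal (frobeniusNormSq (G₀ y)) := by
          rw [setLIntegral_const, mul_comm]
      _ ≤ ∫⁻ t in I, (2 * e t + 2 * (‖θ t‖ₑ ^ 2 * Ig₁)) := by
          refine lintegral_mono_ae ?_
          filter_upwards [hgI] with t ht
          exact hpt t ht
      _ = (2 * ∫⁻ t in I, e t) + 2 * ((∫⁻ t in I, ‖θ t‖ₑ ^ 2) * Ig₁) := by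
          rw [lintegral_add_left' (hem.const_mul _), lintegral_const_mul' _ _ (by norm_num),
            lintegral_const_mul' _ _ (by norm_num), lintegral_mul_const _ (hθm.enorm.pow_const 2)]
      _ ≤ 2 * ENNReal.ofReal ((c : ℝ) * b ^ (1 - ρ)) + 2 * ((∫⁻ t in I, ‖θ t‖ₑ ^ 2) * Ig₁) := by gcongr

end Evanescent

end Summit.NavierStokesRegularity.NavierStokesRegularity.Theorems.PowerGaugeEulerLiouville

end
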